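import Literature.AlgebraicGeometry.Modules.SerreTwistCharts
import HarnessLib

/-!
# Positive Serre twists `N(e) = N ⊗ 𝒪_Z(e)` of a sheaf of modules, by Čech gluing on the standard charts

For `ι : Z ⟶ 𝐏ʳ_A`, a sheaf of `𝒪_Z`-modules `N` and `e : ℕ`, the twist `N(e) = N ⊗ 𝒪_Z(e)` is
constructed here CONCRETELY, without tensor products: a section of `N(e)` over `U` is a family
`(n_j)_j`, `n_j ∈ Γ(U ∩ Z_j, N)` (its expression in the trivialisation of `𝒪(e)` on the chart
`Z_j = ι⁻¹ D₊(x_j)`), subject to the transition rule of `𝒪(e)`,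

  `n_j = (x_{j'} / x_j)^e · n_{j'}` on `U ∩ Z_j ∩ Z_{j'}`

(Hartshorne II.5.12: `𝒪(e)` has transition functions `(x_{j'}/x_j)^e`; Serre FAC nᵒ 54). So
`twistMod ι N e : Z.Modules` is the subsheaf of the product `Π_j (j_j)_* (N|_{Z_j})`
(`chartsModule ι N`, sections `Π_j Γ(U ∩ Z_j, N)`) cut out by these relations. This model makes the
basic identities FORMULAS: `N(0) ≅ N` (sheaf axiom of `N`), `N(e)|_{Z_j} ≅ N|_{Z_j}` (`(n) ↦ n_j`),
multiplication by `x_l : N(e) → N(e+1)` (`(n_j) ↦ ((x_l/x_j) n_j)`), `N(a)(b) ≅ N(a+b)` (the diagonal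
family) and exactness in `N` — all in `Modules/SerreTwistModCharts` and its sequels; they are what the
proof of Serre's vanishing theorem `H¹(Z, N(e)) = 0`, `e ≫ 0` (`Modules/SerreVanishingH1`) runs on.
The negative twists `𝒪_Z(-m)` themselves (needed as honest locally free SOURCES of presentations) are
the word model `serreTwist ι m` of `Modules/SerreTwist`; `𝓗om(𝒪_Z(-m), N) ≅ N(m)` is in
`Modules/SerreTwistHomComparison`.

Contents: `chartsModule ι N` and its section API; the relation `IsTwistFamily`; `twistMod ι N e` with
`twistModι : twistMod ι N e ⟶ chartsModule ι N`, components `comp`, `mkFamily`, extensionality and the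
componentwise formulas for restriction and the `𝒪_Z(U)`-action.

References: Hartshorne II Prop. 5.12; EGA II 2.5; Serre, FAC nᵒ 54. [Hartshorne1977]
-/

noncomputable section

universe u

open CategoryTheory AlgebraicGeometry TopologicalSpace Opposite
open Literature.Algebra.Homology Literature.Algebra.Homology.LaurentCech
open Literature.AlgebraicGeometry.Morphisms Literature.AlgebraicGeometry.Morphisms.ProjCech

attribute [local instance] MvPolynomial.gradedAlgebra
  Literature.AlgebraicGeometry.Motives.ProjBaseChange.algebraBase

namespace Literature.AlgebraicGeometry.Modules

namespace SerreTwist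

variable {A : Type u} [CommRing A] {r : ℕ} {Z : Scheme.{u}} (ι : Z ⟶ PP A r) (N : Z.Modules)

/-! ## The product of the chart pieces `Π_j Γ(U ∩ Z_j, N)` -/

/-- The type of families `(n_j)_j`, `n_j ∈ Γ(U ∩ Z_j, N)`. [folklore] -/
abbrev ChartFamily (U : Z.Opens) : Type u := ∀ j : Fin (r + 1), Γ(N, U ⊓ Zop ι {j})

/-- Restriction of chart families along `V ⊆ U`, componentwise. [folklore] -/
def ChartFamily.res {U V : Z.Opens} (h : V ≤ U) (n : ChartFamily ι N U) : ChartFamily ι N V :=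
  fun j => N.presheaf.map (homOfLE (inf_le_inf_right (Zop ι {j}) h)).op (n j)

/-- Components of a restricted family. [folklore] -/
@[simp]
theorem ChartFamily.res_apply {U V : Z.Opens} (h : V ≤ U) (n : ChartFamily ι N U) (j : Fin (r + 1)) :
    ChartFamily.res ι N h n j = N.presheaf.map (homOfLE (inf_le_inf_right (Zop ι {j}) h)).op (n j) := rfl

/-- The `𝒪_Z(U)`-module structure on chart families: `a • (n_j) = (a|_{U ∩ Z_j} • n_j)`. [folklore] -/
@[reducible]
def ChartFamily.module (U : Z.Opens) : Module Γ(Z, U) (ChartFamily ι N U) :=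
  @Pi.module (Fin (r + 1)) (fun j => Γ(N, U ⊓ Zop ι {j})) Γ(Z, U) _ _ fun j =>
    Module.compHom _ (Z.presheaf.map (homOfLE (inf_le_left : U ⊓ Zop ι {j} ≤ U)).op).hom

attribute [local instance] ChartFamily.module

/-- The action, componentwise. [folklore] -/
theorem ChartFamily.smul_apply {U : Z.Opens} (a : Γ(Z, U)) (n : ChartFamily ι N U) (j : Fin (r + 1)) :
    (a • n) j = Z.presheaf.map (homOfLE (inf_le_left : U ⊓ Zop ι {j} ≤ U)).op a • n j := rfl

omit ι in
/-- Composite restrictions in a module on a scheme. [folklore] -/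
theorem moduleMap_map_apply (M : Z.Modules) {U V V' : Z.Opens} (h : V ≤ U) (h' : V' ≤ V) (s : Γ(M, U)) :
    M.presheaf.map (homOfLE h').op (M.presheaf.map (homOfLE h).op s) = M.presheaf.map (homOfLE (h'.trans h)).op s := by
  rw [← CategoryTheory.comp_apply, ← Functor.map_comp]
  rfl

omit ι in
/-- Proof irrelevance of the inequality in a module restriction. [folklore] -/
theorem moduleMap_congr (M : Z.Modules) {U V : Z.Opens} (h h' : V ≤ U) (s : Γ(M, U)) :
    M.presheaf.map (homOfLE h).op s = M.presheaf.map (homOfLE h').op s := rfl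

/-- The presheaf of abelian groups `U ↦ Π_j Γ(U ∩ Z_j, N)`. [folklore] -/
def chartsPresheafAb : TopCat.Presheaf Ab Z where
  obj U := AddCommGrpCat.of (ChartFamily ι N U.unop)
  map i := AddCommGrpCat.ofHom
    { toFun := ChartFamily.res ι N i.unop.le
      map_zero' := funext fun _ => map_zero _
      map_add' := fun f g => funext fun j => map_add _ (f j) (g j) }
  map_id U := by
    refine AddCommGrpCat.ext fun f => funext fun j => ?_
    change N.presheaf.map _ (f j) = f j
    have : (homOfLE (inf_le_inf_right (Zop ι {j}) (𝟙 U).unop.le)).op = 𝟙 (op (U.unop ⊓ Zop ι {j})) :=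
      Subsingleton.elim _ _
    rw [this, N.presheaf.map_id]; rfl
  map_comp i i' := by
    refine AddCommGrpCat.ext fun f => funext fun j => ?_
    change N.presheaf.map _ (f j) = N.presheaf.map _ (N.presheaf.map _ (f j))
    rw [moduleMap_map_apply]

/-- Restriction of chart families is semilinear over restriction of functions. [folklore] -/
theorem ChartFamily.res_smul {U V : Z.Opens} (h : V ≤ U) (a : Γ(Z, U)) (n : ChartFamily ι N U) :
    ChartFamily.res ι N h (a • n) = Z.presheaf.map (homOfLE h).op a • ChartFamily.res ι N h n := by
  funext j
  rw [ChartFamily.res_apply, ChartFamily.smul_apply, ChartFamily.smul_apply, ChartFamily.res_apply,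
    Scheme.Modules.map_smul, ← CategoryTheory.comp_apply, ← CategoryTheory.comp_apply,
    ← Functor.map_comp, ← Functor.map_comp]
  rfl

/-- The presheaf of `𝒪_Z`-modules `U ↦ Π_j Γ(U ∩ Z_j, N)`. [folklore] -/
def chartsPresheaf : Z.PresheafOfModules :=
  @PresheafOfModules.ofPresheaf _ _ Z.ringCatSheaf.obj (chartsPresheafAb ι N)
    (fun U => ChartFamily.module ι N U.unop)
    (fun _ _ i a f => ChartFamily.res_smul ι N i.unop.le a f)

/-- **`U ↦ Π_j Γ(U ∩ Z_j, N)` is a sheaf** (componentwise gluing in `N` on the covers `(U_a ∩ Z_j)_a`).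
[folklore] -/
theorem isSheaf_chartsPresheaf : TopCat.Presheaf.IsSheaf (chartsPresheaf ι N).presheaf := by
  change TopCat.Presheaf.IsSheaf (chartsPresheafAb ι N)
  rw [TopCat.Presheaf.isSheaf_iff_isSheafUniqueGluing]
  intro κ U sf hsf
  let F : TopCat.Sheaf Ab Z := ⟨N.presheaf, N.isSheaf⟩
  have hcov : ∀ j : Fin (r + 1), iSup U ⊓ Zop ι {j} ≤ ⨆ a, U a ⊓ Zop ι {j} := fun j => by
    rw [← iSup_inf_eq]
  have hsf' : ∀ j : Fin (r + 1), TopCat.Presheaf.IsCompatible F.1 (fun a => U a ⊓ Zop ι {j}) fun a => sf a j := by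
    intro j a b
    have h := congrFun (hsf a b) j
    change N.presheaf.map _ (sf a j) = N.presheaf.map _ (sf b j) at h
    change N.presheaf.map _ (sf a j) = N.presheaf.map _ (sf b j)
    have e1 : U a ⊓ Zop ι {j} ⊓ (U b ⊓ Zop ι {j}) = U a ⊓ U b ⊓ Zop ι {j} := by
      apply le_antisymm
      · exact le_inf (le_inf (inf_le_left.trans inf_le_left) (inf_le_right.trans inf_le_left))
          (inf_le_left.trans inf_le_right)
      · exact le_inf (inf_le_inf_right _ inf_le_left) (inf_le_inf_right _ inf_le_right)
    have key := congrArg (N.presheaf.map (homOfLE e1.le).op) h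
    rw [moduleMap_map_apply, moduleMap_map_apply] at key
    exact key
  have H := fun j => F.existsUnique_gluing' (fun a => U a ⊓ Zop ι {j}) (iSup U ⊓ Zop ι {j})
    (fun a => homOfLE (inf_le_inf_right _ (le_iSup U a))) (hcov j) (fun a => sf a j) (hsf' j)
  refine ⟨fun j => (H j).exists.choose, fun a => funext fun j => (H j).exists.choose_spec a,
    fun t ht => funext fun j => (H j).unique (fun a => ?_) (H j).exists.choose_spec⟩
  exact congrFun (ht a) j

/-- **The product of the chart pieces `Π_j (j_j)_*(N|_{Z_j})`** as a sheaf of `𝒪_Z`-modules: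
sections over `U` are the families `(n_j ∈ Γ(U ∩ Z_j, N))_j`, definitionally. [folklore] -/
def chartsModule : Z.Modules where
  val := chartsPresheaf ι N
  isSheaf := isSheaf_chartsPresheaf ι N

/-- Restriction in `chartsModule` is componentwise. [folklore] -/
theorem chartsModule_map_apply {U V : Z.Opens} (h : V ≤ U) (n : Γ(chartsModule ι N, U)) (j : Fin (r + 1)) :
    ((chartsModule ι N).presheaf.map (homOfLE h).op n) j =
      N.presheaf.map (homOfLE (inf_le_inf_right (Zop ι {j}) h)).op (n j) := rfl

/-- The action on `chartsModule` is componentwise. [folklore] -/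
theorem chartsModule_smul_apply {U : Z.Opens} (a : Γ(Z, U)) (n : Γ(chartsModule ι N, U)) (j : Fin (r + 1)) :
    (a • n) j = Z.presheaf.map (homOfLE (inf_le_left : U ⊓ Zop ι {j} ≤ U)).op a • n j := rfl

/-! ## The twisting relation and the subsheaf `N(e)` -/

variable {ι N}

/-- **The transition rule of `𝒪(e)`** for a chart family `(n_j)`: `n_j = (x_{j'}/x_j)^e · n_{j'}` on every
open `V ⊆ U ∩ Z_j ∩ Z_{j'}`. [folklore] -/
def IsTwistFamily (ι : Z ⟶ PP A r) (N : Z.Modules) (e : ℕ) (U : Z.Opens) (n : ChartFamily ι N U) : Prop :=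
  ∀ (j j' : Fin (r + 1)) ⦃V : Z.Opens⦄ (hV : V ≤ U) (hj : V ≤ Zop ι {j}) (hj' : V ≤ Zop ι {j'}),
    N.presheaf.map (homOfLE (le_inf hV hj)).op (n j) =
      Z.presheaf.map (homOfLE hj).op (chartFun ι j' j) ^ e • N.presheaf.map (homOfLE (le_inf hV hj')).op (n j')

namespace IsTwistFamily

variable {e : ℕ} {U : Z.Opens}

/-- `0` is a twist family. [folklore] -/
theorem zero : IsTwistFamily ι N e U 0 := fun j j' V hV hj hj' => by
  simp only [Pi.zero_apply, map_zero, smul_zero]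

/-- Twist families are stable under addition. [folklore] -/
theorem add {n n' : ChartFamily ι N U} (hn : IsTwistFamily ι N e U n) (hn' : IsTwistFamily ι N e U n') :
    IsTwistFamily ι N e U (n + n') := fun j j' V hV hj hj' => by
  simp only [Pi.add_apply, map_add, smul_add]
  rw [hn j j' hV hj hj', hn' j j' hV hj hj']

/-- Twist families are stable under the action. [folklore] -/
theorem smul (a : Γ(Z, U)) {n : ChartFamily ι N U} (hn : IsTwistFamily ι N e U n) :
    IsTwistFamily ι N e U (a • n) := fun j j' V hV hj hj' => by
  rw [ChartFamily.smul_apply, ChartFamily.smul_apply, Scheme.Modules.map_smul, Scheme.Modules.map_smul,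
    ← CategoryTheory.comp_apply, ← Functor.map_comp, ← CategoryTheory.comp_apply, ← Functor.map_comp,
    hn j j' hV hj hj', smul_smul, smul_smul, mul_comm]
  rfl

/-- Twist families restrict to twist families. [folklore] -/
theorem res {n : ChartFamily ι N U} (hn : IsTwistFamily ι N e U n) {V : Z.Opens} (h : V ≤ U) :
    IsTwistFamily ι N e V (ChartFamily.res ι N h n) := fun j j' V' hV' hj hj' => by
  rw [ChartFamily.res_apply, ChartFamily.res_apply, moduleMap_map_apply, moduleMap_map_apply]
  exact hn j j' (hV'.trans h) hj hj'

end IsTwistFamily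

variable (ι N)

/-- The twist families over `U` form a submodule. [folklore] -/
def twistModSubmoduleObj (e : ℕ) (U : Z.Opens) : Submodule Γ(Z, U) Γ(chartsModule ι N, U) where
  carrier := {n | IsTwistFamily ι N e U n}
  zero_mem' := IsTwistFamily.zero
  add_mem' := IsTwistFamily.add
  smul_mem' := fun a _ hn => IsTwistFamily.smul a hn

/-- **`U ↦ N(e)(U)` is stable under restriction.** [folklore] -/
def twistModSubmodule (e : ℕ) : PresheafOfModules.Submodule (chartsModule ι N).val where
  obj U := twistModSubmoduleObj ι N e U.unop
  map {U V} g := fun n hn => by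
    change IsTwistFamily ι N e V.unop (ChartFamily.res ι N g.unop.le n)
    exact IsTwistFamily.res hn g.unop.le

/-- A family over `⨆ U_a` satisfying the transition rule on every `U_a` satisfies it. [folklore] -/
theorem isTwistFamily_of_locally {e : ℕ} {κ : Type u} (U : κ → Z.Opens) (n : ChartFamily ι N (iSup U))
    (hn : ∀ a, IsTwistFamily ι N e (U a) (ChartFamily.res ι N (le_iSup U a) n)) :
    IsTwistFamily ι N e (iSup U) n := by
  intro j j' V hV hj hj'
  have hcov : V ≤ ⨆ a, V ⊓ U a := by
    rw [← inf_iSup_eq]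
    exact le_inf le_rfl hV
  apply TopCat.Sheaf.eq_of_locally_eq' (⟨N.presheaf, N.isSheaf⟩ : TopCat.Sheaf Ab Z) (fun a => V ⊓ U a) V
    (fun a => homOfLE inf_le_left) hcov
  intro a
  change N.presheaf.map _ (N.presheaf.map _ _) = N.presheaf.map _ (_ • N.presheaf.map _ _)
  rw [Scheme.Modules.map_smul, moduleMap_map_apply, moduleMap_map_apply, map_pow,
    IsTwistSection.map_map_apply]
  have key := hn a j j' (V := V ⊓ U a) inf_le_right (inf_le_left.trans hj) (inf_le_left.trans hj')
  rw [ChartFamily.res_apply, ChartFamily.res_apply, moduleMap_map_apply, moduleMap_map_apply] at key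
  exact key

/-- **`U ↦ N(e)(U)` is a sheaf.** [folklore] -/
theorem isSheaf_twistModSubmodule (e : ℕ) :
    TopCat.Presheaf.IsSheaf (twistModSubmodule ι N e).toPresheafOfModules.presheaf := by
  rw [TopCat.Presheaf.isSheaf_iff_isSheafUniqueGluing]
  intro κ U sf hsf
  let M := chartsModule ι N
  have hsf' : TopCat.Presheaf.IsCompatible M.presheaf U fun a => (sf a).val := fun a b =>
    congrArg Subtype.val (hsf a b)
  obtain ⟨s, hs, huniq⟩ := M.isSheaf.isSheafUniqueGluing U (fun a => (sf a).val) hsf'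
  have hstw : IsTwistFamily ι N e (iSup U) s :=
    isTwistFamily_of_locally ι N U s fun a => by
      have e : (homOfLE (le_iSup U a)).op = (Opens.leSupr U a).op := Subsingleton.elim _ _
      have hsa := hs a
      rw [← e] at hsa
      have : ChartFamily.res ι N (le_iSup U a) s = (sf a).val := hsa
      rw [this]; exact (sf a).2
  refine ⟨⟨s, hstw⟩, fun a => Subtype.ext (hs a), fun t ht => Subtype.ext (huniq t.val fun a => ?_)⟩
  exact congrArg Subtype.val (ht a)

/-- **The Serre twist `N(e) = N ⊗ 𝒪_Z(e)`** (`e ≥ 0`) of a sheaf of modules on a scheme over `𝐏ʳ_A`, by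
Čech gluing: families `(n_j ∈ Γ(U ∩ Z_j, N))_j` with `n_j = (x_{j'}/x_j)^e n_{j'}` (Hartshorne II.5.12).
[cite: Hartshorne1977, II Prop. 5.12 and Def. p. 117] -/
def twistMod (e : ℕ) : Z.Modules :=
  ⟨(twistModSubmodule ι N e).toPresheafOfModules, isSheaf_twistModSubmodule ι N e⟩

/-- The inclusion `N(e) ⟶ Π_j (j_j)_*(N|_{Z_j})`. [folklore] -/
def twistModι (e : ℕ) : twistMod ι N e ⟶ chartsModule ι N := ⟨(twistModSubmodule ι N e).ι⟩

/-- The `j`-th chart piece `n_j ∈ Γ(U ∩ Z_j, N)` of a section `n` of `N(e)` over `U`. [folklore] -/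
def comp {e : ℕ} {U : Z.Opens} (n : Γ(twistMod ι N e, U)) (j : Fin (r + 1)) : Γ(N, U ⊓ Zop ι {j}) :=
  (n : twistModSubmoduleObj ι N e U).val j

/-- Sections of `N(e)` satisfy the transition rule. [folklore] -/
theorem isTwistFamily_comp {e : ℕ} {U : Z.Opens} (n : Γ(twistMod ι N e, U)) : IsTwistFamily ι N e U (comp ι N n) :=
  (n : twistModSubmoduleObj ι N e U).2

/-- Extensionality for sections of `N(e)`. [folklore] -/
@[ext]
theorem twistMod_ext {e : ℕ} {U : Z.Opens} {n n' : Γ(twistMod ι N e, U)} (h : ∀ j, comp ι N n j = comp ι N n' j) :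
    n = n' := Subtype.ext (funext h)

/-- A family satisfying the transition rule is a section of `N(e)`. [folklore] -/
def mkFamily {e : ℕ} {U : Z.Opens} (n : ChartFamily ι N U) (hn : IsTwistFamily ι N e U n) : Γ(twistMod ι N e, U) :=
  (⟨n, hn⟩ : twistModSubmoduleObj ι N e U)

/-- Chart pieces of `mkFamily`. [folklore] -/
@[simp]
theorem comp_mkFamily {e : ℕ} {U : Z.Opens} (n : ChartFamily ι N U) (hn : IsTwistFamily ι N e U n) (j : Fin (r + 1)) :
    comp ι N (mkFamily ι N n hn) j = n j := rfl

/-- Restriction in `N(e)` is componentwise. [folklore] -/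
@[simp]
theorem comp_map {e : ℕ} {U V : Z.Opens} (h : V ≤ U) (n : Γ(twistMod ι N e, U)) (j : Fin (r + 1)) :
    comp ι N ((twistMod ι N e).presheaf.map (homOfLE h).op n) j =
      N.presheaf.map (homOfLE (inf_le_inf_right (Zop ι {j}) h)).op (comp ι N n j) := rfl

/-- The action on `N(e)` is componentwise. [folklore] -/
@[simp]
theorem comp_smul {e : ℕ} {U : Z.Opens} (a : Γ(Z, U)) (n : Γ(twistMod ι N e, U)) (j : Fin (r + 1)) :
    comp ι N (a • n) j = Z.presheaf.map (homOfLE (inf_le_left : U ⊓ Zop ι {j} ≤ U)).op a • comp ι N n j := rfl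

/-- Chart pieces are additive. [folklore] -/
@[simp]
theorem comp_add {e : ℕ} {U : Z.Opens} (n n' : Γ(twistMod ι N e, U)) (j : Fin (r + 1)) :
    comp ι N (n + n') j = comp ι N n j + comp ι N n' j := rfl

/-- Chart pieces of zero. [folklore] -/
@[simp]
theorem comp_zero {e : ℕ} {U : Z.Opens} (j : Fin (r + 1)) : comp ι N (0 : Γ(twistMod ι N e, U)) j = 0 := rfl

/-- The inclusion into the chart product is the family of chart pieces. [folklore] -/
theorem twistModι_app_apply {e : ℕ} (U : Z.Opens) (n : Γ(twistMod ι N e, U)) :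
    (twistModι ι N e).app U n = comp ι N n := rfl

end SerreTwist

end Literature.AlgebraicGeometry.Modules

end
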